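import Mathlib

/-!
# Counting embedded cubes on the spatial torus (`stub_cubeCount`)

Stub `stub_cubeCount` of the crux `BrascampLiebVacuumSC` (stmt-QuantumFields-16404), line
`SketchIdeator1`: on the spatial torus `(ℤ/L)³` (sites `Fin 3 → ZMod L`, link `(y, j)` from `y` to
`y + e_j`, nonnegative link mass `φ y j`), summing `φ` over the valid links of all `L³` translates
`z + cube` of the `n × n × n` cube (cube sites `x : Fin 3 → Fin n`, embedded at `z` as
`fun i => z i + (x i : ZMod L)`, cube links the pairs `(x, j)` with `(x j : ℕ) + 1 < n`) counts each
lattice link at most `n³` times. Pure combinatorics: drop the validity condition using `φ ≥ 0`,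
swap the sums, reindex each translate sum by the bijection `z ↦ z + x` of the finite additive group
`Fin 3 → ZMod L`, and count the `n³` cube sites.
-/

set_option autoImplicit false

open scoped BigOperators

noncomputable section

namespace Summit.QuantumFields.YangMills.Theorems.BrascampLiebVacuumSC

/-- **Counting embedded cubes (`stub_cubeCount`).** On the spatial torus `(ℤ/L)³`, summing a
nonnegative link function `φ` over the valid links of all `L³` translates of the `n × n × n` cube
counts each link of the torus at most `n³` times: for each cube site `x` the translate sum
`∑ z, φ (z + x) j` equals `∑ y, φ y j` (reindex by `z ↦ z + x`), and there are `n³` cube sites. -/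
theorem stub_cubeCount :
    ∀ (L n : ℕ) [NeZero L] (φ : (Fin 3 → ZMod L) → Fin 3 → ℝ), (∀ y j, 0 ≤ φ y j) →
      (∑ z : Fin 3 → ZMod L, ∑ x : Fin 3 → Fin n, ∑ j : Fin 3,
        if (x j : ℕ) + 1 < n then φ (fun i => z i + ((x i : ℕ) : ZMod L)) j else 0) ≤
      (n : ℝ) ^ 3 * ∑ y : Fin 3 → ZMod L, ∑ j : Fin 3, φ y j := by
  intro L n _ φ hφ
  -- each summand is at most the unconditioned mass, since `φ ≥ 0`
  have h1 : ∀ (z : Fin 3 → ZMod L) (x : Fin 3 → Fin n) (j : Fin 3),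
      (if (x j : ℕ) + 1 < n then φ (fun i => z i + ((x i : ℕ) : ZMod L)) j else 0) ≤
        φ (fun i => z i + ((x i : ℕ) : ZMod L)) j := by
    intro z x j
    split_ifs
    · exact le_rfl
    · exact hφ _ _
  -- translation invariance of the sum over the torus
  have h2 : ∀ (x : Fin 3 → Fin n) (j : Fin 3),
      ∑ z : Fin 3 → ZMod L, φ (fun i => z i + ((x i : ℕ) : ZMod L)) j =
        ∑ y : Fin 3 → ZMod L, φ y j := by
    intro x j
    exact Fintype.sum_equiv (Equiv.addRight (fun i => ((x i : ℕ) : ZMod L))) _ _ (fun z => rfl)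
  calc (∑ z : Fin 3 → ZMod L, ∑ x : Fin 3 → Fin n, ∑ j : Fin 3,
        if (x j : ℕ) + 1 < n then φ (fun i => z i + ((x i : ℕ) : ZMod L)) j else 0)
      ≤ ∑ z : Fin 3 → ZMod L, ∑ x : Fin 3 → Fin n, ∑ j : Fin 3,
          φ (fun i => z i + ((x i : ℕ) : ZMod L)) j := by
        gcongr with z _ x _ j _
        exact h1 z x j
    _ = ∑ x : Fin 3 → Fin n, ∑ j : Fin 3, ∑ z : Fin 3 → ZMod L,
          φ (fun i => z i + ((x i : ℕ) : ZMod L)) j := by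
        rw [Finset.sum_comm]
        refine Finset.sum_congr rfl (fun x _ => ?_)
        rw [Finset.sum_comm]
    _ = ∑ x : Fin 3 → Fin n, ∑ j : Fin 3, ∑ y : Fin 3 → ZMod L, φ y j := by
        simp only [h2]
    _ = (n : ℝ) ^ 3 * ∑ y : Fin 3 → ZMod L, ∑ j : Fin 3, φ y j := by
        rw [Finset.sum_const, Finset.card_univ, Fintype.card_fun, Fintype.card_fin,
          Fintype.card_fin, nsmul_eq_mul, Finset.sum_comm]
        push_cast
        ring

end Summit.QuantumFields.YangMills.Theorems.BrascampLiebVacuumSC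

end
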